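import Summits.CriticalPhenomena.PercolationContinuityZ3.Theorems.SahiMasterFamilyStructSym

/-!
# Structure theory of the zero-flag class, VI: locality, and shrinking by a frame-independent event (Lemma I′)

Unit `prim-master-conj` (crux anchor stmt-CriticalPhenomena-4575); STRUCTURE-THEORY.md §3.9 (gen 6).
* Locality (`goodChain_congr`, `structured_congr`, `safe_congr`, `frameIn_congr`): good chains, structuredness, the safe region and the
  frames of a family only depend on the events of its members — needed because shrinking one member is modelled by
  `Function.update U t (U t ∩ B)`.
* **Lemma I′** (`goodChain_update_inter_of_disjoint`): if `B` is a nonempty increasing event whose support misses the frame support of a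
  good chain, then replacing any member `U t` by `U t ∩ B` leaves the chain good IN THE SAME ORDER, the frame of `t` becoming
  `frame ∩ B` and all other frames unchanged.
Pure combinatorics; axioms standard. [this work]
-/

noncomputable section

open scoped Classical

namespace Summit.CriticalPhenomena.PercolationContinuityZ3.Theorems

open Finset Function
open Literature.Probability.LatticeModels.Kahn2022 (Affects)

variable {ι : Type*} [Fintype ι] {κ : Type*}

/-! ### Locality -/

section Congr

variable {U₁ U₂ : κ → Set (Set ι)}

/-- The frame support only depends on the members of the chain. [this work] -/
theorem frameSupp_congr : ∀ {l : List κ}, (∀ w ∈ l, U₁ w = U₂ w) → frameSupp U₁ l = frameSupp U₂ l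
  | [], _ => rfl
  | v :: l, h => by
    simp only [frameSupp]
    rw [frameSupp_congr (fun w hw => h w (List.mem_cons_of_mem v hw)), h v (List.mem_cons_self)]

/-- Frames only depend on the members of the chain. [this work] -/
theorem frameIn_congr : ∀ {l : List κ}, (∀ w ∈ l, U₁ w = U₂ w) → ∀ {w : κ}, w ∈ l → frameIn U₁ l w = frameIn U₂ l w
  | [], _, _, hw => absurd hw List.not_mem_nil
  | v :: l, h, w, hw => by
    by_cases hwv : w = v
    · subst hwv
      rw [frameIn_cons_self, frameIn_cons_self, frameSupp_congr (fun w hw => h w (List.mem_cons_of_mem _ hw)),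
        h w (List.mem_cons_self)]
    · rw [frameIn_cons_of_ne U₁ hwv, frameIn_cons_of_ne U₂ hwv]
      exact frameIn_congr (fun w hw => h w (List.mem_cons_of_mem v hw)) (List.mem_of_ne_of_mem hwv hw)

omit [Fintype ι] in
/-- The fail set only depends on the members. [this work] -/
theorem failSet_congr {W : Finset κ} (h : ∀ w ∈ W, U₁ w = U₂ w) (φ : Set ι) : failSet U₁ W φ = failSet U₂ W φ := by
  ext w; simp only [mem_failSet]
  constructor
  · rintro ⟨hw, hφ⟩; exact ⟨hw, by rwa [← h w hw]⟩
  · rintro ⟨hw, hφ⟩; exact ⟨hw, by rwa [h w hw]⟩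

/-- **Locality of good chains and structuredness** (joint induction on the size). [this work] -/
theorem goodChain_congr_aux : ∀ (n : ℕ) {U₁ U₂ : κ → Set (Set ι)} {l : List κ}, l.length ≤ n →
    (∀ w ∈ l, U₁ w = U₂ w) → GoodChain U₁ l → GoodChain U₂ l
  | 0, _, _, l, hn, _, _ => by
    have : l = [] := List.eq_nil_of_length_eq_zero (Nat.le_zero.1 hn)
    subst this; exact goodChain_nil _
  | n + 1, U₁, U₂, l, hn, h, hl => by
    match l, hn, h, hl with
    | [], _, _, _ => exact goodChain_nil _
    | v :: l₀, hn, h, hl =>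
      rw [goodChain_cons] at hl ⊢
      obtain ⟨hl₀, hv, hN⟩ := hl
      have h₀ : ∀ w ∈ l₀, U₁ w = U₂ w := fun w hw => h w (List.mem_cons_of_mem v hw)
      have hlen : l₀.length ≤ n := by simp only [List.length_cons] at hn; omega
      refine ⟨goodChain_congr_aux n hlen h₀ hl₀, hv, ?_⟩
      rw [← frameSupp_congr h₀, ← h v (List.mem_cons_self)]
      intro φ hφ
      obtain ⟨h2, hsup⟩ := (mem_safe U₁).1 (hN hφ)
      rw [mem_safe, ← failSet_congr (fun w hw => h₀ w (List.mem_toFinset.1 hw))]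
      refine ⟨h2, fun R hR1 hR2 => ?_⟩
      obtain ⟨l', hl'R, hl'n, hl'len, hl'⟩ := Structured.exists_chain U₁ (hsup R hR1 hR2)
      have hlen' : l'.length ≤ n := by
        rw [hl'len]
        exact (card_le_card hR2).trans ((List.toFinset_card_le l₀).trans hlen)
      exact ⟨l', hl'R, goodChain_congr_aux n hlen' (fun w hw => h₀ w (List.mem_toFinset.1 (hR2 (hl'R ▸ List.mem_toFinset.2 hw)))) hl'⟩

/-- Good chains only depend on the members. [this work] -/
theorem goodChain_congr {l : List κ} (h : ∀ w ∈ l, U₁ w = U₂ w) : GoodChain U₁ l ↔ GoodChain U₂ l :=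
  ⟨goodChain_congr_aux l.length le_rfl h, goodChain_congr_aux l.length le_rfl fun w hw => (h w hw).symm⟩

/-- Structuredness only depends on the members. [this work] -/
theorem structured_congr {W : Finset κ} (h : ∀ w ∈ W, U₁ w = U₂ w) : Structured U₁ W ↔ Structured U₂ W := by
  constructor
  · rintro ⟨l, hlW, hl⟩; exact ⟨l, hlW, (goodChain_congr fun w hw => h w (hlW ▸ List.mem_toFinset.2 hw)).1 hl⟩
  · rintro ⟨l, hlW, hl⟩; exact ⟨l, hlW, (goodChain_congr fun w hw => h w (hlW ▸ List.mem_toFinset.2 hw)).2 hl⟩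

/-- The safe region only depends on the members. [this work] -/
theorem safe_congr {W : Finset κ} (h : ∀ w ∈ W, U₁ w = U₂ w) : Safe U₁ W = Safe U₂ W := by
  ext φ
  simp only [mem_safe, failSet_congr h]
  constructor
  · rintro ⟨h2, hs⟩; exact ⟨h2, fun R h1 h2' => (structured_congr fun w hw => h w (h2' hw)).1 (hs R h1 h2')⟩
  · rintro ⟨h2, hs⟩; exact ⟨h2, fun R h1 h2' => (structured_congr fun w hw => h w (h2' hw)).2 (hs R h1 h2')⟩

end Congr

/-! ### Shrinking one member -/

section Update

variable (U : κ → Set (Set ι))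

omit [Fintype ι] in
/-- Shrinking one member keeps all members increasing. [this work] -/
theorem isUpperSet_update_inter_family (hU : ∀ k, IsUpperSet (U k)) (t : κ) {B : Set (Set ι)} (hB : IsUpperSet B) :
    ∀ k, IsUpperSet (update U t (U t ∩ B) k) := by
  intro k
  by_cases hk : k = t
  · subst hk; rw [update_self]; exact (hU k).inter hB
  · rw [update_of_ne hk]; exact hU k

omit [Fintype ι] in
/-- Shrinking one member by a nonempty increasing event keeps all members nonempty. [this work] -/
theorem nonempty_update_inter_family (hU : ∀ k, IsUpperSet (U k)) (hne : ∀ k, (U k).Nonempty) (t : κ) {B : Set (Set ι)}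
    (hB : IsUpperSet B) (hBne : B.Nonempty) : ∀ k, (update U t (U t ∩ B) k).Nonempty := by
  intro k
  by_cases hk : k = t
  · subst hk; rw [update_self]
    exact ⟨Set.univ, univ_mem_of_nonempty (hU k) (hne k), univ_mem_of_nonempty hB hBne⟩
  · rw [update_of_ne hk]; exact hne k

omit [Fintype ι] in
/-- The shrunk family agrees with the old one off `t`. [this work] -/
theorem update_inter_of_ne {t : κ} (B : Set (Set ι)) {w : κ} (h : w ≠ t) : update U t (U t ∩ B) w = U w := update_of_ne h _ _

/-- **Lemma I′ (STRUCTURE-THEORY 3.9): shrinking a member by a frame-independent event keeps the chain good in the same order**, the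
frame of the shrunk member becoming `frame ∩ B` and the other frames unchanged. [this work] -/
theorem goodChain_update_inter_of_disjoint (hU : ∀ k, IsUpperSet (U k)) (hne : ∀ k, (U k).Nonempty) {B : Set (Set ι)}
    (hB : IsUpperSet B) (hBne : B.Nonempty) :
    ∀ (n : ℕ) {l : List κ}, l.length ≤ n → GoodChain U l → Disjoint (↑(esupp B) : Set ι) (frameSupp U l) → ∀ {t : κ}, t ∈ l →
      GoodChain (update U t (U t ∩ B)) l ∧ frameIn (update U t (U t ∩ B)) l t = frameIn U l t ∩ B ∧
        ∀ w ∈ l, w ≠ t → frameIn (update U t (U t ∩ B)) l w = frameIn U l w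
  | 0, l, hn, _, _, t, ht => by
    have : l = [] := List.eq_nil_of_length_eq_zero (Nat.le_zero.1 hn)
    subst this; exact absurd ht List.not_mem_nil
  | n + 1, l, hn, hl, hdisj, t, ht => by
    match l, hn, hl, hdisj, ht with
    | v :: l₀, hn, hl, hdisj, ht =>
      set U' := update U t (U t ∩ B) with hU'def
      have hl₀ : GoodChain U l₀ := GoodChain.tail U hl
      have hv : v ∉ l₀ := ((goodChain_cons U).1 hl).2.1
      have hNv : hull (frameSupp U l₀) (U v) \ U v ⊆ Safe U l₀.toFinset := ((goodChain_cons U).1 hl).2.2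
      have hlen : l₀.length ≤ n := by simp only [List.length_cons] at hn; omega
      have hdisj₀ : Disjoint (↑(esupp B) : Set ι) (frameSupp U l₀) :=
        hdisj.mono_right (by rw [frameSupp_cons]; exact Set.subset_union_left)
      have hBhull : ∀ S : Set ι, S ⊆ frameSupp U (v :: l₀) → hull S B = B :=
        fun S hS => hull_eq_self_of_disjoint hB (Set.disjoint_left.2 fun i hiS hiB => Set.disjoint_left.1 hdisj hiB (hS hiS))
      by_cases htv : t = v
      · -- shrinking the head
        subst htv
        have hU'₀ : ∀ w ∈ l₀, U' w = U w := fun w hw => update_inter_of_ne U B (fun h => hv (h ▸ hw))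
        have hS₀ : frameSupp U' l₀ = frameSupp U l₀ := frameSupp_congr hU'₀
        have hframe : frameIn U' (t :: l₀) t = frameIn U (t :: l₀) t ∩ B := by
          rw [frameIn_cons_self, frameIn_cons_self, hS₀, hU'def, update_self, hull_inter,
            hBhull _ (by rw [frameSupp_cons]; exact Set.subset_union_left)]
        refine ⟨?_, hframe, fun w hw hwt => ?_⟩
        · rw [goodChain_cons]
          refine ⟨(goodChain_congr hU'₀).2 hl₀, hv, ?_⟩
          rw [← frameIn_cons_self, hframe, frameIn_cons_self, safe_congr (fun w hw => hU'₀ w (List.mem_toFinset.1 hw)),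
            hU'def, update_self]
          intro φ hφ
          exact hNv ⟨hφ.1.1, fun h => hφ.2 ⟨h, hφ.1.2⟩⟩
        · rw [frameIn_cons_of_ne _ hwt, frameIn_cons_of_ne _ hwt]
          exact frameIn_congr hU'₀ (List.mem_of_ne_of_mem hwt hw)
      · -- shrinking inside the tail: induction, then the head keeps its frame and annihilator
        have ht₀ : t ∈ l₀ := List.mem_of_ne_of_mem htv ht
        obtain ⟨hl₀', hft, hfo⟩ := goodChain_update_inter_of_disjoint hU hne hB hBne n hlen hl₀ hdisj₀ ht₀
        have hU'v : U' v = U v := update_inter_of_ne U B (Ne.symm htv)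
        -- the new frame support of the tail: old one plus part of `esupp B`
        have hS' : frameSupp U' l₀ ⊆ frameSupp U l₀ ∪ ↑(esupp B) := by
          rw [frameSupp_eq_biUnion U' (GoodChain.nodup U hl₀), frameSupp_eq_biUnion U (GoodChain.nodup U hl₀)]
          intro i hi
          rw [Set.mem_iUnion₂] at hi
          obtain ⟨w, hw, hiw⟩ := hi
          have hwl : w ∈ l₀ := List.mem_toFinset.1 hw
          by_cases hwt : w = t
          · subst hwt
            rw [hft] at hiw
            rcases mem_union.1 (esupp_inter_subset _ _ (mem_coe.1 hiw)) with h1 | h2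
            · exact Set.mem_union_left _ (Set.mem_iUnion₂.2 ⟨w, hw, mem_coe.2 h1⟩)
            · exact Set.mem_union_right _ (mem_coe.2 h2)
          · rw [hfo w hwl hwt] at hiw
            exact Set.mem_union_left _ (Set.mem_iUnion₂.2 ⟨w, hw, hiw⟩)
        have hS'' : frameSupp U l₀ ⊆ frameSupp U' l₀ := by
          rw [frameSupp_eq_biUnion U' (GoodChain.nodup U hl₀), frameSupp_eq_biUnion U (GoodChain.nodup U hl₀)]
          intro i hi
          rw [Set.mem_iUnion₂] at hi ⊢
          obtain ⟨w, hw, hiw⟩ := hi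
          have hwl : w ∈ l₀ := List.mem_toFinset.1 hw
          refine ⟨w, hw, ?_⟩
          by_cases hwt : w = t
          · subst hwt
            rw [hft]
            -- `esupp (frame) ⊆ esupp (frame ∩ B)` since `B` ignores the frame's coordinates and is nonempty
            refine mem_coe.2 (esupp_subset_esupp_inter (isUpperSet_frameIn U hU l₀ w) hB hBne ?_ (mem_coe.1 hiw))
            exact Finset.disjoint_left.2 fun e he heB =>
              Set.disjoint_left.1 hdisj₀ (mem_coe.2 heB) (esupp_frameIn_subset_frameSupp U hwl (mem_coe.2 he))
          · rwa [hfo w hwl hwt]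
        -- the head's frame is unchanged (L2(b))
        have hframe : frameIn U' (v :: l₀) v = frameIn U (v :: l₀) v := by
          rw [frameIn_cons_self, hU'v]
          refine hull_eq_frameIn_head U hU v l₀ hS'' (Set.disjoint_left.2 fun i hi hiv => ?_)
          rcases hS' hi with h1 | h2
          · exact Set.disjoint_left.1 (disjoint_frameSupp_esupp_frameIn_head U v l₀) h1 hiv
          · refine Set.disjoint_left.1 hdisj h2 ?_
            rw [frameSupp_cons]; exact Set.mem_union_right _ hiv
        refine ⟨?_, ?_, fun w hw hwt => ?_⟩
        · rw [goodChain_cons]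
          refine ⟨hl₀', hv, ?_⟩
          rw [← frameIn_cons_self, hframe, frameIn_cons_self, hU'v]
          -- the old annihilator is safe for the shrunk tail
          intro φ hφ
          have hφs := hNv hφ
          obtain ⟨h2, hsup⟩ := (mem_safe U).1 hφs
          rw [mem_safe]
          have hfail : failSet U l₀.toFinset φ ⊆ failSet U' l₀.toFinset φ := by
            intro w hw
            rw [mem_failSet] at hw ⊢
            refine ⟨hw.1, fun h => hw.2 ?_⟩
            by_cases hwt : w = t
            · subst hwt
              have e : U' w = U w ∩ B := by rw [hU'def, update_self]
              rw [e] at h; exact h.1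
            · have e : U' w = U w := update_inter_of_ne U B hwt
              rwa [e] at h
          refine ⟨h2.trans (card_le_card hfail), fun R hR1 hR2 => ?_⟩
          have hRs : Structured U R := hsup R (hfail.trans hR1) hR2
          by_cases htR : t ∈ R
          · -- `R` is robust, so its frames are restricted and `B` is frame-independent for it: induction
            have hrob : ∀ R', R ⊆ R' → R' ⊆ l₀.toFinset → Structured U R' := fun R' h1 h2' => hsup R' ((hfail.trans hR1).trans h1) h2'
            obtain ⟨lR, hlR, hlRn, hlRlen, hglR⟩ := Structured.exists_chain U hRs
            have hlenR : lR.length ≤ n := by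
              rw [hlRlen]; exact (card_le_card hR2).trans ((List.toFinset_card_le l₀).trans hlen)
            have hdisjR : Disjoint (↑(esupp B) : Set ι) (frameSupp U lR) := by
              rw [frameSupp_eq_biUnion_cframe U hU hne hglR, hlR, Set.disjoint_left]
              intro i hiB hi
              rw [Set.mem_iUnion₂] at hi
              obtain ⟨w, hw, hiw⟩ := hi
              rw [cframe_eq_of_robust U hU hne _ le_rfl ⟨l₀, rfl, hl₀⟩ hR2 hrob w hw,
                ← frameIn_eq_cframe U hU hne hl₀ (List.mem_toFinset.1 (hR2 hw))] at hiw
              exact Set.disjoint_left.1 hdisj₀ hiB (esupp_frameIn_subset_frameSupp U (List.mem_toFinset.1 (hR2 hw)) hiw)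
            have htlR : t ∈ lR := List.mem_toFinset.1 (by rw [hlR]; exact htR)
            exact ⟨lR, hlR, (goodChain_update_inter_of_disjoint hU hne hB hBne n hlenR hglR hdisjR htlR).1⟩
          · have hagree : ∀ w ∈ R, U w = U' w := by
              intro w hw
              have hwt : w ≠ t := fun h => htR (h ▸ hw)
              exact (update_inter_of_ne U B hwt).symm
            exact (structured_congr hagree).1 hRs
        · rw [frameIn_cons_of_ne _ htv, frameIn_cons_of_ne _ htv]; exact hft
        · by_cases hwv : w = v
          · subst hwv; exact hframe
          · rw [frameIn_cons_of_ne _ hwv, frameIn_cons_of_ne _ hwv]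
            exact hfo w (List.mem_of_ne_of_mem hwv hw) hwt

end Update

end Summit.CriticalPhenomena.PercolationContinuityZ3.Theorems
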